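import Literature.AlgebraicGeometry.HodgeTheory.BettiHodgeGroupTrivialDualDegrees
import HarnessLib

/-!
# `b₁(X) = 2q(X)`, the vanishing of odd cohomology on a diagonal Hodge diamond, and varieties of HODGE–TATE TYPE (`h^{p,q}(X) = 0` for `p ≠ q`): every `H^{2p}(X)`
# is purely of type `(p,p)`, every Hodge group `Hg(H^{2p}(X))` is trivial, `MT = 𝔾_m` on points, `H², H^{2n−2}` algebraic; surfaces with `p_g = q = 0` are of Hodge–Tate type
# (Voisin I Cor. 6.12–6.13, Thm. 6.25, Thm. 11.30; Voisin II §11.1.1; Green–Griffiths–Kerr §I.C p. 45; Carlson–Müller-Stach–Peters 15.2.4 (i))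

Family `hodge`, lane `lit-hodgefound` (Track 2 foundations library; Layers A1/A4), layer `Literature/AlgebraicGeometry/HodgeTheory`.  THEOREMS ONLY (no definition,
no named fact, no instance; D-0026 net debt `0`).  Sequel of the seat's g24-#3/#4/#5: with `b_k = Σ_{p ≤ k} h^{p,k−p}` (g24-#4) and Hodge symmetry, the irregularity
`q(X) = h^{1,0}(X)` gives `b₁(X) = 2q(X)` («if the surface `X` is also regular, i.e. … `q(X) := dim H^{1,0}(X)` is zero … then `Alb X = 0`», Voisin II §11.1.1), an
odd degree `k` whose off-diagonal Hodge numbers vanish has `Hᵏ(X(ℂ); ℚ) = 0`, and a variety of HODGE–TATE TYPE — all `h^{p,q}(X) = 0` for `p ≠ q` (a diagonal Hodge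
diamond: projective spaces, Grassmannians, toric and cellular varieties, rational surfaces, Enriques surfaces …) — has NO odd rational cohomology and every
even-degree group purely of type `(p,p)`: all its Hodge groups are trivial (g24-#2/#3), its Mumford–Tate groups are `𝔾_m` on points, and its `H²` and
`H^{2n−2}` consist of algebraic classes (Lefschetz `(1,1)` and the curve classes, g24-#3/#5).  A smooth projective SURFACE with `p_g = q = 0` is of Hodge–Tate type
(`h^{1,0} = h^{0,1} = h^{2,1} = h^{1,2} = 0` by symmetry and duality, `h^{2,0} = h^{0,2} = 0`).

THE PRINTS.  C. Voisin (2002) [VoisinHodgeI2002] §6.1.3 Cor. 6.12 (`h^{p,q} = h^{q,p}`), Cor. 6.13 («`b_k = Σ_{p+q=k} h^{p,q}` … In particular, the odd Betti numbers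
`b_{2k+1}` … are even»), §6.3.2 proof of Thm. 6.33 («we used Poincaré duality here»), Thm. 11.30.  C. Voisin (2003) [VoisinHodgeII2003] §11.1.1 (PDF p0268)
«`p_g(X) := dim H^{2,0}(X)`», «regular, i.e. … `q(X) := dim H^{1,0}(X)` is zero».  M. Green, P. Griffiths, M. Kerr (2012) [GreenGriffithsKerr2012] §I.C p0045
«since `V_ℂ = ⊕_p V^{p,p}`, `φ` is trivial and so `M_φ = {1}`», §I.A p0033 («Hodge-Tate structure»).  J. Carlson, S. Müller-Stach, C. Peters (2017)
[CarlsonMullerStachPeters2017] §15.2 Examples 15.2.4 (i) (p0369).  M. Kerr, G. Pearlstein (2011) [KerrPearlstein2011] §3.1 (curve classes).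

THE OBJECTS (all the tree's).  `X : SchemeOver ℂ`, `hX : IsSmoothProjective n X`, `hHD : exists_isReal_hodgeModel`; `Hᵏ(X) = BettiUniverse.hodge hHD hX k` with
`hodgeNumber`, `hodgeClasses`, `hodgeGroupBaseChange K`, `mumfordTateGroupBaseChange K`; `bettiCohomology X k`; `algebraicClasses X p`; `ofRatClass`.

WHAT IS PROVED.
* §1 IRREGULARITY: **`BettiUniverse.finrank_bettiCohomology_one_eq_two_mul`** (`b₁(X) = 2 h^{1,0}(X)`), `BettiUniverse.finrank_bettiCohomology_one_eq_zero_iff`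
  (`H¹(X(ℂ); ℚ) = 0 ⟺ q(X) = 0`), `BettiUniverse.finrank_bettiCohomology_eq_zero_of_odd_of_forall_hodgeNumber_eq_zero` (odd `k`, `h^{p,q}(Hᵏ) = 0` for `p ≠ q` ⟹ `b_k = 0`).
* §2 HODGE–TATE TYPE (`hHT : ∀ k p q, p + q = k → p ≠ q → h^{p,q}(Hᵏ(X)) = 0`): `BettiUniverse.hodgeClasses_hodge_eq_top_of_hodgeTateType` (every `H^{2p}` pure),
  **`BettiUniverse.hodgeGroupBaseChange_hodge_eq_bot_of_hodgeTateType`** (`Hg(H^{2p}(X))(K) = 1` for all `p`, every `K`),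
  `BettiUniverse.finrank_bettiCohomology_eq_zero_of_hodgeTateType` (no odd cohomology), `BettiUniverse.mem_mumfordTateGroupBaseChange_hodge_iff_of_hodgeTateType`
  (`MT(H^{2p}(X))(K) = K^× · id`, `1 ≤ p ≤ n`), `ofRatClass_mem_algebraicClasses_one_of_hodgeTateType` / `_curveDegree_of_hodgeTateType` (`H²`, `H^{2n−2}` algebraic).
* §3 SURFACES WITH `p_g = q = 0`: **`BettiUniverse.hodgeTateType_of_surface_pg_q_zero`** (`h^{1,0} = h^{2,0} = 0 ⟹` Hodge–Tate type), whence
  `BettiUniverse.hodgeGroupBaseChange_hodge_eq_bot_of_surface_pg_q_zero` (ALL `Hg(Hᵏ(S))(K) = 1`, `k` even), `BettiUniverse.finrank_bettiCohomology_eq_zero_of_surface_pg_q_zero`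
  (`H¹(S(ℂ); ℚ) = H³(S(ℂ); ℚ) = 0`).

DEVIATIONS / SCOPE.  Hodge–Tate type is a HYPOTHESIS on the Hodge numbers; no variety is proved to satisfy it here beyond the surface criterion `p_g = q = 0`.

## References
* [VoisinHodgeI2002] C. Voisin, *Hodge Theory and Complex Algebraic Geometry I* (2002) — §6.1.3 Cor. 6.12–6.13, §6.2.3 Thm. 6.25, §6.3.2 proof of Thm. 6.33, §7.1.2, Thm. 11.30.
* [VoisinHodgeII2003] C. Voisin, *Hodge Theory and Complex Algebraic Geometry II* (2003) — §11.1.1 (PDF p. 268).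
* [GreenGriffithsKerr2012] M. Green, P. A. Griffiths, M. Kerr, *Mumford–Tate Groups and Domains* (2012) — §I.A p. 33, §I.C p. 45.
* [CarlsonMullerStachPeters2017] J. Carlson, S. Müller-Stach, C. Peters, *Period Mappings and Period Domains*, 2nd ed. (2017) — §15.2 Examples 15.2.4 (i) (p. 369).
* [KerrPearlstein2011] M. Kerr, G. Pearlstein (2011) — §3.1.

## Provenance
Lane `lit-hodgefound` (Hodge path, Track 2), prover seat `lit-hodgefound-p29` (generation 24), self-proposed row g24-#6.
-/

noncomputable section

open scoped TensorProduct
open CategoryTheory Module Finset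
open Literature.AlgebraicTopology.SingularHomology

namespace Literature.AlgebraicGeometry.HodgeTheory

open Literature.AlgebraicGeometry.Motives
open Literature.AlgebraicGeometry.Motives.HodgeStructure

universe w

variable {n : ℕ} {X : SchemeOver ℂ}

/-! ### §1 The irregularity: `b₁ = 2 h^{1,0}`; odd degrees with diagonal Hodge numbers vanish -/

/-- **`b₁(X) = 2q(X)`**: `dim_ℚ H¹(X(ℂ); ℚ) = 2 h^{1,0}(X)` (`b₁ = h^{1,0} + h^{0,1}` and Hodge symmetry). [cite: VoisinHodgeI2002, §6.1.3 Cor. 6.12 and Cor. 6.13]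
[cite: VoisinHodgeII2003, §11.1.1 (PDF p. 268)] -/
theorem BettiUniverse.finrank_bettiCohomology_one_eq_two_mul (hHD : exists_isReal_hodgeModel) (hX : IsSmoothProjective n X) :
    Module.finrank ℚ (bettiCohomology X 1) = 2 * (BettiUniverse.hodge hHD hX 1).hodgeNumber 1 0 := by
  rw [BettiUniverse.finrank_bettiCohomology_eq_sum_hodgeNumber_hodge hHD hX 1]
  simp only [Finset.sum_range_succ, Finset.sum_range_zero, zero_add, Nat.cast_zero, Nat.cast_one, Nat.sub_zero, Nat.sub_self]
  rw [BettiUniverse.hodgeNumber_hodge_symm hHD hX 1 0 1]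
  ring

/-- **`H¹(X(ℂ); ℚ) = 0 ⟺ q(X) = h^{1,0}(X) = 0`** («regular»). [cite: VoisinHodgeII2003, §11.1.1 (PDF p. 268)] [cite: VoisinHodgeI2002, §6.1.3 Cor. 6.13] -/
theorem BettiUniverse.finrank_bettiCohomology_one_eq_zero_iff (hHD : exists_isReal_hodgeModel) (hX : IsSmoothProjective n X) :
    Module.finrank ℚ (bettiCohomology X 1) = 0 ↔ (BettiUniverse.hodge hHD hX 1).hodgeNumber 1 0 = 0 := by
  rw [BettiUniverse.finrank_bettiCohomology_one_eq_two_mul hHD hX]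
  omega

/-- **An odd degree `k` all of whose off-diagonal Hodge numbers vanish has `Hᵏ(X(ℂ); ℚ) = 0`** (`p + q = k` odd forces `p ≠ q`, so every `h^{p,q} = 0` and
`b_k = Σ h^{p,q} = 0`). [cite: VoisinHodgeI2002, §6.1.3 Cor. 6.13] -/
theorem BettiUniverse.finrank_bettiCohomology_eq_zero_of_odd_of_forall_hodgeNumber_eq_zero (hHD : exists_isReal_hodgeModel) (hX : IsSmoothProjective n X)
    {k : ℕ} (hk : Odd k) (h : ∀ p q : ℕ, p + q = k → p ≠ q → (BettiUniverse.hodge hHD hX k).hodgeNumber p q = 0) :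
    Module.finrank ℚ (bettiCohomology X k) = 0 := by
  rw [BettiUniverse.finrank_bettiCohomology_eq_sum_hodgeNumber_hodge hHD hX k]
  refine Finset.sum_eq_zero fun p hp => h p (k - p) (by have := Finset.mem_range.1 hp; omega) fun hpq => ?_
  obtain ⟨m, rfl⟩ := hk
  have := Finset.mem_range.1 hp
  omega

/-! ### §2 Varieties of Hodge–Tate type: `h^{p,q}(X) = 0` for all `p ≠ q` -/

section HodgeTateType

/-- **Hodge–Tate type ⟹ every `H^{2p}(X)` is purely of type `(p,p)`**: all rational classes of even degree are Hodge classes (g24-#3's criterion).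
[cite: GreenGriffithsKerr2012, §I.C p. 45 (before Remark (I.C.14)) and §I.A p. 33] [cite: VoisinHodgeI2002, §11.3.1 Def. 11.28] -/
theorem BettiUniverse.hodgeClasses_hodge_eq_top_of_hodgeTateType (hHD : exists_isReal_hodgeModel) (hX : IsSmoothProjective n X)
    (hHT : ∀ k p q : ℕ, p + q = k → p ≠ q → (BettiUniverse.hodge hHD hX k).hodgeNumber p q = 0) (p : ℕ) :
    (BettiUniverse.hodge hHD hX (2 * p)).hodgeClasses p = ⊤ :=
  BettiUniverse.hodgeClasses_hodge_eq_top_of_forall_hodgeNumber_eq_zero hHD hX (by push_cast; ring) fun a b hab hap =>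
    hHT (2 * p) a b hab fun h => hap (by subst h; omega)

/-- **Hodge–Tate type ⟹ `Hg(H^{2p}(X))(K) = 1` for every `p` and every field `K ⊇ ℚ`** (all Hodge groups of the even cohomology are trivial).
[cite: GreenGriffithsKerr2012, §I.C p. 45 (before Remark (I.C.14))] [cite: CarlsonMullerStachPeters2017, §15.2 Examples 15.2.4 (i) (p. 369)] -/
theorem BettiUniverse.hodgeGroupBaseChange_hodge_eq_bot_of_hodgeTateType [HodgeTensorFacts.{0, 0}] (hHD : exists_isReal_hodgeModel) (hX : IsSmoothProjective n X)
    (K : Type w) [Field K] [Algebra ℚ K] (hHT : ∀ k p q : ℕ, p + q = k → p ≠ q → (BettiUniverse.hodge hHD hX k).hodgeNumber p q = 0) (p : ℕ)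
    [Module.Finite ℚ (bettiCohomology X (2 * p))] : (BettiUniverse.hodge hHD hX (2 * p)).hodgeGroupBaseChange K = ⊥ :=
  (BettiUniverse.hodge hHD hX (2 * p)).hodgeGroupBaseChange_eq_bot_of_hodgeClasses_eq_top K (p := (p : ℤ)) (by push_cast; ring)
    (BettiUniverse.hodgeClasses_hodge_eq_top_of_hodgeTateType hHD hX hHT p)

/-- **Hodge–Tate type ⟹ no odd rational cohomology**: `Hᵏ(X(ℂ); ℚ) = 0` for every odd `k` («the odd Betti numbers are even» degenerates to `0`).
[cite: VoisinHodgeI2002, §6.1.3 Cor. 6.13] -/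
theorem BettiUniverse.finrank_bettiCohomology_eq_zero_of_hodgeTateType (hHD : exists_isReal_hodgeModel) (hX : IsSmoothProjective n X)
    (hHT : ∀ k p q : ℕ, p + q = k → p ≠ q → (BettiUniverse.hodge hHD hX k).hodgeNumber p q = 0) {k : ℕ} (hk : Odd k) :
    Module.finrank ℚ (bettiCohomology X k) = 0 :=
  BettiUniverse.finrank_bettiCohomology_eq_zero_of_odd_of_forall_hodgeNumber_eq_zero hHD hX hk (hHT k)

/-- **Hodge–Tate type ⟹ `MT(H^{2p}(X))(K) = K^× · id` exactly** for `1 ≤ p ≤ dim X` and every field `K ⊇ ℚ` (`𝔾_m` on points; weight `2p ≠ 0`, `H^{2p} ≠ 0`).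
[cite: CarlsonMullerStachPeters2017, §15.2 Examples 15.2.4 (i) (p. 369)] [cite: GreenGriffithsKerr2012, §I.B p. 35 and §I.C p. 45] -/
theorem BettiUniverse.mem_mumfordTateGroupBaseChange_hodge_iff_of_hodgeTateType [HodgeTensorFacts.{0, 0}] (hHD : exists_isReal_hodgeModel)
    (hX : IsSmoothProjective n X) (K : Type w) [Field K] [Algebra ℚ K]
    (hHT : ∀ k p q : ℕ, p + q = k → p ≠ q → (BettiUniverse.hodge hHD hX k).hodgeNumber p q = 0) {p : ℕ} (hp1 : 1 ≤ p) (hpn : p ≤ n)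
    [Module.Finite ℚ (bettiCohomology X (2 * p))] (γ : (K ⊗[ℚ] bettiCohomology X (2 * p)) ≃ₗ[K] (K ⊗[ℚ] bettiCohomology X (2 * p))) :
    γ ∈ (BettiUniverse.hodge hHD hX (2 * p)).mumfordTateGroupBaseChange K ↔ ∃ c : Kˣ, γ = LinearEquiv.smulOfUnit c := by
  haveI : Nontrivial (bettiCohomology X (2 * p)) := nontrivial_bettiCohomology_two_mul_of_le hX hpn
  exact (BettiUniverse.hodge hHD hX (2 * p)).mem_mumfordTateGroupBaseChange_iff_exists_eq_smulOfUnit_of_hodgeClasses_eq_top K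
    (by have : 2 * p ≠ 0 := by omega
        exact_mod_cast this) (p := (p : ℤ)) (by push_cast; ring) (BettiUniverse.hodgeClasses_hodge_eq_top_of_hodgeTateType hHD hX hHT p) γ

/-- **Hodge–Tate type ⟹ every class of `H²(X(ℂ); ℚ)` is a divisor class** (`h^{2,0} = 0` and Lefschetz `(1,1)`, g24-#3).
[cite: VoisinHodgeI2002, Thm. 11.30 and §11.3.3] [cite: GreenGriffithsKerr2012, §I.C p. 45 (before Remark (I.C.14))] -/
theorem ofRatClass_mem_algebraicClasses_one_of_hodgeTateType (hHD : exists_isReal_hodgeModel) (hX : IsSmoothProjective n X)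
    (hHT : ∀ k p q : ℕ, p + q = k → p ≠ q → (BettiUniverse.hodge hHD hX k).hodgeNumber p q = 0) (v : bettiCohomology X 2) :
    ofRatClass (ComplexPoints X) 2 v ∈ algebraicClasses X 1 :=
  ofRatClass_mem_algebraicClasses_one_of_pg_zero hHD hX (by exact_mod_cast hHT 2 2 0 rfl (by omega)) v

/-- **Hodge–Tate type ⟹ every class of `H^{2n−2}(X(ℂ); ℚ)` is a curve class** (`n ≥ 1`; g24-#5). [cite: KerrPearlstein2011, §3.1]
[cite: VoisinHodgeI2002, Thm. 6.25 and Thm. 11.30] -/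
theorem ofRatClass_mem_algebraicClasses_curveDegree_of_hodgeTateType (hHD : exists_isReal_hodgeModel) (hX : IsSmoothProjective n X) (hn : 1 ≤ n)
    (hHT : ∀ k p q : ℕ, p + q = k → p ≠ q → (BettiUniverse.hodge hHD hX k).hodgeNumber p q = 0) (v : bettiCohomology X (2 * (n - 1))) :
    ofRatClass (ComplexPoints X) (2 * (n - 1)) v ∈ algebraicClasses X (n - 1) :=
  ofRatClass_mem_algebraicClasses_curveDegree_of_pg_zero hHD hX hn (by exact_mod_cast hHT 2 2 0 rfl (by omega)) v

end HodgeTateType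

/-! ### §3 Surfaces with `p_g = q = 0` are of Hodge–Tate type -/

section Surface

variable (hX : IsSmoothProjective 2 X)

/-- **A smooth projective surface with `p_g = q = 0` is of Hodge–Tate type**: `h^{p,q}(S) = 0` for all `p ≠ q` (`h^{1,0} = h^{0,1} = 0`, `h^{2,0} = h^{0,2} = 0`,
`h^{2,1} = h^{1,2} = h^{0,1} = 0` by the Serre–Poincaré duality of g24-#4, and no `(p,q)` with `p > 2` or `q > 2`).
[cite: VoisinHodgeII2003, §11.1.1 (PDF p. 268)] [cite: VoisinHodgeI2002, §6.1.3 Cor. 6.12 and §6.3.2 proof of Thm. 6.33] -/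
theorem BettiUniverse.hodgeTateType_of_surface_pg_q_zero (hHD : exists_isReal_hodgeModel) (h10 : (BettiUniverse.hodge hHD hX 1).hodgeNumber 1 0 = 0)
    (h20 : (BettiUniverse.hodge hHD hX 2).hodgeNumber 2 0 = 0) :
    ∀ k p q : ℕ, p + q = k → p ≠ q → (BettiUniverse.hodge hHD hX k).hodgeNumber p q = 0 := by
  intro k p q hpq hne
  by_cases hp2 : 2 < p
  · exact BettiUniverse.hodgeNumber_hodge_eq_zero_of_lt_fst hHD hX hpq hp2
  by_cases hq2 : 2 < q
  · exact BettiUniverse.hodgeNumber_hodge_eq_zero_of_lt_snd hHD hX hpq hq2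
  have h01 : (BettiUniverse.hodge hHD hX 1).hodgeNumber 0 1 = 0 := by
    rw [BettiUniverse.hodgeNumber_hodge_symm hHD hX 1 0 1]; exact_mod_cast h10
  have h02 : (BettiUniverse.hodge hHD hX 2).hodgeNumber 0 2 = 0 := by
    rw [BettiUniverse.hodgeNumber_hodge_symm hHD hX 2 0 2]; exact_mod_cast h20
  -- the remaining off-diagonal pairs with `p, q ≤ 2`
  interval_cases p <;> interval_cases q <;> simp only [ne_eq, not_true_eq_false] at hne <;> subst hpq
  · exact_mod_cast h01
  · exact_mod_cast h02
  · exact_mod_cast h10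
  · -- `h^{1,2}(H³) = h^{1,0}(H¹)`
    rw [BettiUniverse.hodgeNumber_hodge_duality_of_eq hHD hX (a := 1) (b := 2) (a' := 1) (b' := 0) rfl rfl rfl rfl]
    exact_mod_cast h10
  · exact_mod_cast h20
  · -- `h^{2,1}(H³) = h^{0,1}(H¹)`
    rw [BettiUniverse.hodgeNumber_hodge_duality_of_eq hHD hX (a := 2) (b := 1) (a' := 0) (b' := 1) rfl rfl rfl rfl]
    exact_mod_cast h01

/-- **Surfaces with `p_g = q = 0`: ALL Hodge groups `Hg(Hᵏ(S))(K)`, `k` even, are trivial** (every field `K ⊇ ℚ`).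
[cite: GreenGriffithsKerr2012, §I.C p. 45 (before Remark (I.C.14))] [cite: VoisinHodgeII2003, §11.1.1 (PDF p. 268)] -/
theorem BettiUniverse.hodgeGroupBaseChange_hodge_eq_bot_of_surface_pg_q_zero [HodgeTensorFacts.{0, 0}] (hHD : exists_isReal_hodgeModel) (K : Type w) [Field K]
    [Algebra ℚ K] (h10 : (BettiUniverse.hodge hHD hX 1).hodgeNumber 1 0 = 0) (h20 : (BettiUniverse.hodge hHD hX 2).hodgeNumber 2 0 = 0) (p : ℕ)
    [Module.Finite ℚ (bettiCohomology X (2 * p))] : (BettiUniverse.hodge hHD hX (2 * p)).hodgeGroupBaseChange K = ⊥ :=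
  BettiUniverse.hodgeGroupBaseChange_hodge_eq_bot_of_hodgeTateType hHD hX K (BettiUniverse.hodgeTateType_of_surface_pg_q_zero hX hHD h10 h20) p

/-- **Surfaces with `p_g = q = 0` have no odd rational cohomology**: `H¹(S(ℂ); ℚ) = 0` and `H³(S(ℂ); ℚ) = 0` (and trivially beyond).
[cite: VoisinHodgeI2002, §6.1.3 Cor. 6.13] [cite: VoisinHodgeII2003, §11.1.1 (PDF p. 268)] -/
theorem BettiUniverse.finrank_bettiCohomology_eq_zero_of_surface_pg_q_zero (hHD : exists_isReal_hodgeModel)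
    (h10 : (BettiUniverse.hodge hHD hX 1).hodgeNumber 1 0 = 0) (h20 : (BettiUniverse.hodge hHD hX 2).hodgeNumber 2 0 = 0) {k : ℕ} (hk : Odd k) :
    Module.finrank ℚ (bettiCohomology X k) = 0 :=
  BettiUniverse.finrank_bettiCohomology_eq_zero_of_hodgeTateType hHD hX (BettiUniverse.hodgeTateType_of_surface_pg_q_zero hX hHD h10 h20) hk

end Surface

end Literature.AlgebraicGeometry.HodgeTheory

end
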